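import Literature.NumberTheory.IwasawaTheory.IwasawaAlgebraProjectiveLimit
import HarnessLib

/-!
# The `Λ`-adic Artin element of a COMPATIBLE FAMILY `b = (b_j) ∈ lim← (ℤ/p^{j+1})ˣ`:
# `∃! W ∈ Λ, W ≡ c·(1+T)^{r_j(b_j)} (mod h_j)` for all `j`, and `W ∈ Λˣ` when `c ∈ ℤ_pˣ`

Literature support for the `𝒞₇` genus road (cell bsd-cm, seat bsd-cm-k-ty1 g26, SUMMON GENUS-UNIT-A5 File D = memo S8):
the tree's `IsLogTable.exists_artinElement` (`IwasawaAlgebraProjectiveLimit.lean`) builds `N − c·σ_N ∈ Λ` for ONE integer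
`N` prime to `p` read at every level; here the integer varies with the level along a `p`-adically compatible family
`b_{j+1} ≡ b_j (mod p^{j+1})` (the torsor coordinate of a system of primitive roots of unity under a complex embedding),
and the element `W(b) = lim_j c·(1+T)^{r_j(b_j)}` — the image in `Λ = ℤ_p⟦Γ⟧` of `c·⟨b⟩`, `⟨b⟩ = γ^{a(b)}` the projection
of the `p`-adic unit `b = lim b_j` to `1 + pℤ_p` — EXISTS, is UNIQUE, and is a UNIT of `Λ` when `c` is a unit (its
constant coefficient is `c`).  THEOREMS ONLY (no definition, no named fact, no instance).

## Main statements

* `one_add_X_pow_sub_mem_span_layerModulus_of_pow_sub_mem`: `u^a ≡ u^b (mod p^{j+1}) ⇒ (1+T)^a ≡ (1+T)^b (mod h_j)`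
  (`u` a topological generator of `1 + pℤ_p`, `p` odd) — the tail of the tree's one-integer proof, isolated.
* `IsLogTable.one_add_X_pow_sub_mem_span_layerModulus_family`: for a `γ`-log table `r` and a compatible family `b`
  prime to `p`, `(1+T)^{r_{j+1}(b_{j+1})} ≡ (1+T)^{r_j(b_j)} (mod h_j)`.
* `IsLogTable.exists_artinElementFamily`, `IsLogTable.existsUnique_artinElementFamily`: `∃! W, ∀ j,
  W − C c·(1+T)^{r_j(b_j)} ∈ (h_j)` (Lang Ch. 5 §1 Thm 1.1, both halves, from the tree).
* `constantCoeff_eq_of_sub_mem_span_layerModulus_zero`, `isUnit_of_artinElementFamily`: `h_0 = T`, so `W(0) = c` and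
  `W ∈ Λˣ` iff `c ∈ ℤ_pˣ` (`Λ` local: a power series is a unit iff its constant coefficient is).

## References
S. Lang, *Cyclotomic Fields I and II*, GTM 121 (1990), Ch. 5 §1 Thm 1.1 (PDF pp. 115–116, `Λ ≅ lim 𝔬[X]/(h_n)`), Ch. 10 §1
(PDF pp. 167–168, `r(a)`, `⟨a⟩ = γ^{α(a)}`, `h_n`) [Lang1990]; L. Washington, *Introduction to Cyclotomic Fields* (1997) §7.2
Thm 7.10 (the same `Λ`-adic interpolation of `σ_a`) [Washington1997].
-/

noncomputable section

open PowerSeries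

namespace Literature.NumberTheory.IwasawaTheory

open StickelbergerSeries Literature.NumberTheory.EllipticCurves

section Family

variable {p : ℕ} [Fact p.Prime]

/-- **`u^a ≡ u^b (mod p^{j+1}) ⇒ (1+T)^a ≡ (1+T)^b (mod h_j)`** for `p` odd and `u` a topological generator of `1 + pℤ_p`
(`u^{|a−b|} ≡ 1 ⇒ pʲ ∣ a − b` by the order of `u`, then `h_j ∣ (1+T)^{pʲm} − 1`).
[cite: Lang1990, Ch. 10 §1 Thm 1.2 (PDF p. 168, «r(a) … well defined mod pⁿ»)] -/
theorem one_add_X_pow_sub_mem_span_layerModulus_of_pow_sub_mem (hp : p ≠ 2) {u : ℤ_[p]}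
    (hu : KubotaLeopoldt.IsTopGenerator p u) {j a b : ℕ}
    (h : u ^ a - u ^ b ∈ Ideal.span {(p : ℤ_[p]) ^ (j + 1)}) :
    ((1 + X : IwasawaAlgebra p) ^ a - (1 + X) ^ b) ∈ Ideal.span {layerModulus p j} := by
  have huu : IsUnit u := hu.isUnit
  rcases le_total b a with hab | hab
  · have h3 : u ^ (a - b) - 1 ∈ Ideal.span {(p : ℤ_[p]) ^ (j + 1)} := by
      have e : u ^ a - u ^ b = u ^ b * (u ^ (a - b) - 1) := by
        rw [mul_sub, mul_one, ← pow_add, Nat.add_sub_cancel' hab]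
      rw [e] at h
      exact (Ideal.unit_mul_mem_iff_mem _ (huu.pow _)).mp h
    exact one_add_X_pow_sub_pow_mem_span_layerModulus (hu.prime_pow_dvd_of_pow_sub_one_mem p hp h3) hab
  · have h3 : u ^ (b - a) - 1 ∈ Ideal.span {(p : ℤ_[p]) ^ (j + 1)} := by
      have e : u ^ a - u ^ b = -(u ^ a * (u ^ (b - a) - 1)) := by
        rw [mul_sub, mul_one, ← pow_add, Nat.add_sub_cancel' hab, neg_sub]
      rw [e, Ideal.neg_mem_iff] at h
      exact (Ideal.unit_mul_mem_iff_mem _ (huu.pow _)).mp h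
    rw [← Ideal.neg_mem_iff, neg_sub]
    exact one_add_X_pow_sub_pow_mem_span_layerModulus (hu.prime_pow_dvd_of_pow_sub_one_mem p hp h3) hab

/-- A `p`-adically compatible family read modulo `p`: `b_{j+1} ≡ b_j (mod p^{j+1}) ⇒ b_{j+1} = b_j` in `ℤ/p`. [folklore] -/
private theorem natCast_zmod_eq_of_modEq {b : ℕ → ℕ} (hcompat : ∀ j : ℕ, b (j + 1) ≡ b j [MOD p ^ (j + 1)]) (j : ℕ) :
    ((b (j + 1) : ℕ) : ZMod p) = (b j : ZMod p) :=
  (ZMod.natCast_eq_natCast_iff _ _ _).mpr ((hcompat j).of_dvd (dvd_pow_self p (Nat.succ_ne_zero j)))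

/-- `b_{j+1} ≡ b_j (mod p^{j+1})` read in `ℤ_p`: `b_{j+1} − b_j ∈ (p^{j+1})`. [folklore] -/
private theorem natCast_sub_natCast_mem_span_pow_of_modEq {b : ℕ → ℕ} (hcompat : ∀ j : ℕ, b (j + 1) ≡ b j [MOD p ^ (j + 1)])
    (j : ℕ) : ((b (j + 1) : ℕ) : ℤ_[p]) - (b j : ℤ_[p]) ∈ Ideal.span {(p : ℤ_[p]) ^ (j + 1)} := by
  have hd : ((p : ℤ) ^ (j + 1)) ∣ ((b (j + 1) : ℕ) : ℤ) - ((b j : ℕ) : ℤ) :=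
    (Nat.modEq_iff_dvd.mp (hcompat j).symm)
  obtain ⟨q, hq⟩ := hd
  refine Ideal.mem_span_singleton.mpr ⟨(q : ℤ_[p]), ?_⟩
  have := congrArg (fun z : ℤ => (z : ℤ_[p])) hq
  push_cast at this
  exact this

/-- **The layers `(1+T)^{r_j(b_j)}` of a `γ`-log table along a COMPATIBLE FAMILY are compatible modulo `h_j`** (`p` odd,
every `b_j` prime to `p`, `b_{j+1} ≡ b_j (mod p^{j+1})`): `u^{r_{j+1}(b_{j+1})}ω(b_{j+1}) ≡ b_{j+1} ≡ b_j ≡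
u^{r_j(b_j)}ω(b_j) (mod p^{j+1})` and `ω(b_{j+1}) = ω(b_j)`, so `u^{r_{j+1}(b_{j+1})} ≡ u^{r_j(b_j)}` and
`(1+T)^{r_{j+1}(b_{j+1})} ≡ (1+T)^{r_j(b_j)} (mod h_j)` — the image of `⟨b⟩` in `ℤ_p[Γ_j]` is well defined.
[cite: Lang1990, Ch. 10 §1 Thm 1.2 (PDF p. 168, «r(a) … well defined mod pⁿ»)] [cite: Washington1997, §7.2 Thm 7.10] -/
theorem StickelbergerSeries.IsLogTable.one_add_X_pow_sub_mem_span_layerModulus_family (hp : p ≠ 2) {u : ℤ_[p]}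
    (hu : KubotaLeopoldt.IsTopGenerator p u) {ω : DirichletCharacter ℤ_[p] p} {r : ℕ → ℕ → ℕ} (hr : IsLogTable p u ω r)
    {b : ℕ → ℕ} (hb : ∀ j : ℕ, (b j).Coprime p) (hcompat : ∀ j : ℕ, b (j + 1) ≡ b j [MOD p ^ (j + 1)]) (j : ℕ) :
    ((1 + X : IwasawaAlgebra p) ^ (r (j + 1) (b (j + 1))) - (1 + X) ^ (r j (b j))) ∈ Ideal.span {layerModulus p j} := by
  have hω : ω ((b (j + 1) : ℕ) : ZMod p) = ω (b j : ZMod p) := by rw [natCast_zmod_eq_of_modEq hcompat j]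
  -- `(u^{r_{j+1}(b_{j+1})} − u^{r_j(b_j)})·ω(b_j) ∈ (p^{j+1})`
  have h1 : (u ^ (r (j + 1) (b (j + 1))) - u ^ (r j (b j))) * ω (b j : ZMod p) ∈
      Ideal.span {(p : ℤ_[p]) ^ (j + 1)} := by
    have e : (u ^ (r (j + 1) (b (j + 1))) - u ^ (r j (b j))) * ω (b j : ZMod p) =
        (u ^ (r (j + 1) (b (j + 1))) * ω ((b (j + 1) : ℕ) : ZMod p) - (b (j + 1) : ℕ)) -
          (u ^ (r j (b j)) * ω (b j : ZMod p) - (b j : ℕ)) + (((b (j + 1) : ℕ) : ℤ_[p]) - (b j : ℕ)) := by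
      rw [hω]; ring
    rw [e]
    refine Ideal.add_mem _ (Ideal.sub_mem _ ?_ (hr j (b j) (hb j))) (natCast_sub_natCast_mem_span_pow_of_modEq hcompat j)
    exact Ideal.span_singleton_le_span_singleton.mpr (pow_dvd_pow _ (Nat.le_succ _)) (hr (j + 1) (b (j + 1)) (hb (j + 1)))
  -- cancel the unit `ω(b_j)`
  have hωu : IsUnit (ω (b j : ZMod p)) := by
    have hNu : IsUnit ((b j : ℕ) : ZMod p) := by rw [← ZMod.coe_unitOfCoprime (b j) (hb j)]; exact Units.isUnit _
    exact hNu.map ω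
  exact one_add_X_pow_sub_mem_span_layerModulus_of_pow_sub_mem hp hu ((Ideal.mul_unit_mem_iff_mem _ hωu).mp h1)

/-- **The `Λ`-adic Artin element of a compatible family EXISTS**: for `p` odd, `u` a topological generator with `γ`-log
table `r`, a family `b_j` prime to `p` with `b_{j+1} ≡ b_j (mod p^{j+1})`, and any `c ∈ ℤ_p`, some `W ∈ Λ` satisfies
`W ≡ c·(1+T)^{r_j(b_j)} (mod h_j)` for every `j` (`Λ → lim← Λ/(h_j)` is onto, Lang Ch. 5 §1 Thm 1.1).
[cite: Lang1990, Ch. 5 §1 Thm. 1.1 (PDF pp. 115–116) with Ch. 10 §1 Thm 1.2 (PDF p. 168)] [cite: Washington1997, §7.2 Thm 7.10] -/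
theorem StickelbergerSeries.IsLogTable.exists_artinElementFamily (hp : p ≠ 2) {u : ℤ_[p]}
    (hu : KubotaLeopoldt.IsTopGenerator p u) {ω : DirichletCharacter ℤ_[p] p} {r : ℕ → ℕ → ℕ} (hr : IsLogTable p u ω r)
    {b : ℕ → ℕ} (hb : ∀ j : ℕ, (b j).Coprime p) (hcompat : ∀ j : ℕ, b (j + 1) ≡ b j [MOD p ^ (j + 1)]) (c : ℤ_[p]) :
    ∃ W : IwasawaAlgebra p, ∀ j : ℕ, W - C c * (1 + X) ^ (r j (b j)) ∈ Ideal.span {layerModulus p j} := by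
  refine exists_forall_sub_mem_span_layerModulus p _ fun j => ?_
  rw [← mul_sub]
  exact Ideal.mul_mem_left _ _ (hr.one_add_X_pow_sub_mem_span_layerModulus_family hp hu hb hcompat j)

/-- **… and UNIQUELY** (`⋂ⱼ (h_j) = 0`, the tree's `eq_of_forall_sub_mem_span_layerModulus`).
[cite: Lang1990, Ch. 5 §1 Thm. 1.1 (PDF pp. 115–116)] -/
theorem StickelbergerSeries.IsLogTable.existsUnique_artinElementFamily (hp : p ≠ 2) {u : ℤ_[p]}
    (hu : KubotaLeopoldt.IsTopGenerator p u) {ω : DirichletCharacter ℤ_[p] p} {r : ℕ → ℕ → ℕ} (hr : IsLogTable p u ω r)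
    {b : ℕ → ℕ} (hb : ∀ j : ℕ, (b j).Coprime p) (hcompat : ∀ j : ℕ, b (j + 1) ≡ b j [MOD p ^ (j + 1)]) (c : ℤ_[p]) :
    ∃! W : IwasawaAlgebra p, ∀ j : ℕ, W - C c * (1 + X) ^ (r j (b j)) ∈ Ideal.span {layerModulus p j} := by
  obtain ⟨W, hW⟩ := hr.exists_artinElementFamily hp hu hb hcompat c
  exact ⟨W, hW, fun W' hW' => eq_of_forall_sub_mem_span_layerModulus p _ hW' hW⟩

/-- `h_0 = T`: congruence modulo `h_0` is equality of constant coefficients. [cite: Lang1990, Ch. 10 §1 (PDF p. 167, «h_0 = X»)] -/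
theorem constantCoeff_eq_of_sub_mem_span_layerModulus_zero {W g : IwasawaAlgebra p}
    (h : W - g ∈ Ideal.span {layerModulus p 0}) : constantCoeff W = constantCoeff g := by
  rw [layerModulus_zero, Ideal.mem_span_singleton, PowerSeries.X_dvd_iff, map_sub, sub_eq_zero] at h
  exact h

/-- **The constant coefficient of the Artin element of a family is `c`** (read the level-`0` congruence modulo `h_0 = T`:
`(1+T)^{r}` has constant coefficient `1`). [cite: Lang1990, Ch. 10 §1 (PDF p. 167)] -/
theorem constantCoeff_of_artinElementFamily {W : IwasawaAlgebra p} {c : ℤ_[p]} {r₀ : ℕ}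
    (hW : W - C c * (1 + X) ^ r₀ ∈ Ideal.span {layerModulus p 0}) : constantCoeff W = c := by
  rw [constantCoeff_eq_of_sub_mem_span_layerModulus_zero hW]
  simp

/-- **`W(b) ∈ Λˣ` when `c ∈ ℤ_pˣ`**: a power series over the local ring `ℤ_p` is a unit iff its constant coefficient is,
and the constant coefficient of the Artin element of a family is `c`. [cite: Lang1990, Ch. 5 §1 (PDF p. 115, «Λ is a local ring with maximal ideal (p, X)»)] -/
theorem isUnit_of_artinElementFamily {W : IwasawaAlgebra p} {c : ℤ_[p]} {r₀ : ℕ}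
    (hW : W - C c * (1 + X) ^ r₀ ∈ Ideal.span {layerModulus p 0}) (hc : IsUnit c) : IsUnit W := by
  rw [PowerSeries.isUnit_iff_constantCoeff, constantCoeff_of_artinElementFamily hW]
  exact hc

/-- **Multiplicativity of the reading**: if `W ≡ c·(1+T)^{m} (mod h_j)` and `W' ≡ c'·(1+T)^{m'} (mod h_j)` then
`W·W' ≡ (c c')·(1+T)^{m+m'} (mod h_j)` — the Artin elements of families multiply like the group elements `c⟨b⟩` they
interpolate. [cite: Lang1990, Ch. 10 §1 (PDF p. 167)] -/
theorem mul_sub_mem_span_layerModulus_of_sub_mem {W W' : IwasawaAlgebra p} {c c' : ℤ_[p]} {m m' j : ℕ}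
    (hW : W - C c * (1 + X) ^ m ∈ Ideal.span {layerModulus p j})
    (hW' : W' - C c' * (1 + X) ^ m' ∈ Ideal.span {layerModulus p j}) :
    W * W' - C (c * c') * (1 + X) ^ (m + m') ∈ Ideal.span {layerModulus p j} := by
  have e : W * W' - C (c * c') * (1 + X) ^ (m + m') =
      (W - C c * (1 + X) ^ m) * W' + C c * (1 + X) ^ m * (W' - C c' * (1 + X) ^ m') := by
    rw [map_mul, pow_add]; ring
  rw [e]
  exact Ideal.add_mem _ (Ideal.mul_mem_right _ _ hW) (Ideal.mul_mem_left _ _ hW')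

/-- **The inverse reading**: if `W ≡ c·(1+T)^{m} (mod h_j)` with `c ∈ ℤ_pˣ` and `W ∈ Λˣ`, and `(1+T)^{m}·(1+T)^{m'} ≡ 1
(mod h_j)` (`pʲ ∣ m + m'`), then `W⁻¹ ≡ c⁻¹·(1+T)^{m'} (mod h_j)` — the translate `σ_b⁻¹` reads as `W(b)⁻¹`.
[cite: Lang1990, Ch. 10 §1 (PDF p. 167)] -/
theorem inv_sub_mem_span_layerModulus_of_sub_mem {W : (IwasawaAlgebra p)ˣ} {c : ℤ_[p]ˣ} {m m' j : ℕ}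
    (hW : (W : IwasawaAlgebra p) - C (c : ℤ_[p]) * (1 + X) ^ m ∈ Ideal.span {layerModulus p j})
    (hmm' : ((1 + X : IwasawaAlgebra p) ^ m * (1 + X) ^ m' - 1) ∈ Ideal.span {layerModulus p j}) :
    ((W⁻¹ : (IwasawaAlgebra p)ˣ) : IwasawaAlgebra p) - C ((c⁻¹ : ℤ_[p]ˣ) : ℤ_[p]) * (1 + X) ^ m' ∈
      Ideal.span {layerModulus p j} := by
  -- multiply the target by the unit `W · C c`: `W·C c·(W⁻¹ − c⁻¹(1+T)^{m'}) = C c − W(1+T)^{m'}`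
  have hunit : IsUnit ((W : IwasawaAlgebra p) * C (c : ℤ_[p])) :=
    (Units.isUnit W).mul ((Units.isUnit c).map C)
  rw [← Ideal.unit_mul_mem_iff_mem _ hunit]
  have e : (W : IwasawaAlgebra p) * C (c : ℤ_[p]) *
      (((W⁻¹ : (IwasawaAlgebra p)ˣ) : IwasawaAlgebra p) - C ((c⁻¹ : ℤ_[p]ˣ) : ℤ_[p]) * (1 + X) ^ m') =
      -(((W : IwasawaAlgebra p) - C (c : ℤ_[p]) * (1 + X) ^ m) * (1 + X) ^ m' +
        C (c : ℤ_[p]) * ((1 + X : IwasawaAlgebra p) ^ m * (1 + X) ^ m' - 1)) := by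
    have h1 : (W : IwasawaAlgebra p) * ((W⁻¹ : (IwasawaAlgebra p)ˣ) : IwasawaAlgebra p) = 1 := Units.mul_inv W
    have h2 : C (c : ℤ_[p]) * C ((c⁻¹ : ℤ_[p]ˣ) : ℤ_[p]) = (1 : IwasawaAlgebra p) := by
      rw [← map_mul, Units.mul_inv, map_one]
    calc (W : IwasawaAlgebra p) * C (c : ℤ_[p]) *
          (((W⁻¹ : (IwasawaAlgebra p)ˣ) : IwasawaAlgebra p) - C ((c⁻¹ : ℤ_[p]ˣ) : ℤ_[p]) * (1 + X) ^ m')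
        = C (c : ℤ_[p]) * ((W : IwasawaAlgebra p) * ((W⁻¹ : (IwasawaAlgebra p)ˣ) : IwasawaAlgebra p)) -
            (W : IwasawaAlgebra p) * (C (c : ℤ_[p]) * C ((c⁻¹ : ℤ_[p]ˣ) : ℤ_[p])) * (1 + X) ^ m' := by ring
      _ = _ := by rw [h1, h2]; ring
  rw [e, Ideal.neg_mem_iff]
  exact Ideal.add_mem _ (Ideal.mul_mem_right _ _ hW) (Ideal.mul_mem_left _ _ hmm')

/-- `(1+T)^{m}·(1+T)^{m'} ≡ 1 (mod h_j)` when `pʲ ∣ m + m'`. [cite: Lang1990, Ch. 10 §1 (PDF p. 167, «h_n = (1+X)^{pⁿ} − 1»)] -/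
theorem one_add_X_pow_mul_pow_sub_one_mem_span_layerModulus {m m' j : ℕ} (h : p ^ j ∣ m + m') :
    ((1 + X : IwasawaAlgebra p) ^ m * (1 + X) ^ m' - 1) ∈ Ideal.span {layerModulus p j} := by
  rw [← pow_add]
  have := one_add_X_pow_sub_pow_mem_span_layerModulus (p := p) (j := j) (a := m + m') (b := 0)
    (by simpa using h) (Nat.zero_le _)
  simpa using this

end Family

end Literature.NumberTheory.IwasawaTheory

end
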